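import Summits.AtomisticToContinuum.HydrodynamicLimit.Theses.JParityClosure
import Summits.AtomisticToContinuum.HydrodynamicLimit.Theorems.JParityClosureParityBandClosureInverseCollisionInvariance
import Summits.AtomisticToContinuum.HydrodynamicLimit.Theorems.OneFlightGossipEngineKacPairHeatFlux
import Mathlib.MeasureTheory.Measure.ProbabilityMeasure
import Mathlib.MeasureTheory.Measure.FiniteMeasure
import Mathlib.MeasureTheory.Measure.Prokhorov
import Mathlib.MeasureTheory.Measure.LevyProkhorovMetric
import HarnessLib

/-!
# Parity stability of the single-pair parity chain — helper file A: compactness and moment tools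

Support file for the stub `stub_parityStabilityOfRigidity` of the line `transfer-weighted-parity-chain`
(skeleton v3) of the crux `JParityClosure.ParityBandClosure` (stmt-AtomisticToContinuum-17608); the
assembly itself is `JParityClosureParityBandClosureParityStabilityOfRigidity.lean`, which imports this file.

WHAT (all elementary, no statement of the line is used here):
* §1 `exists_subseq_tendsto_of_tight` — SEQUENTIAL Prokhorov for FINITE measures on a separable
  metrizable Borel space: masses `≤ C` and `μ_n (K_mᶜ) ≤ u_m → 0` (`K_m` compact) give a weakly
  convergent subsequence.
* §2 `measureReal_compl_le_div` — Markov's inequality in real form.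
* §3 weak convergence tested on bare bounded continuous functions (`tendsto_integral_of_tendsto`), the
  squeeze `limit_eq_zero_of_abs_le`, and `1/(φ n + 1) → 0` along a subsequence.
* §4 moments of laws on `ℝ³` under a cubic bound: `a² ≤ 1 + a³`, `a ≤ 1 + a³`, integrability of the
  second moment / coordinates / products of coordinates, the expansion of a central second moment in
  raw moments (`integral_central`) and its convergence along a sequence whose raw moments converge
  (`tendsto_central`).
* §5 the stage tests of the assembly: `Ψ = Φ − Φ ∘ J` is continuous, bounded and `J`-odd for the
  inverse collision `J q = (collide q.2 q.1, −q.2)` (a continuous involution, landed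
  `continuous_inverseCollision`, `inverseCollision_inverseCollision`); the balance test
  `c(v′) + c(w′) − c(v) − c(w)` is continuous and bounded; the floor arithmetic `floor_le_div`.
* §6 `exists_subseq_pair` — velocity laws with `∫ |v|³ ≤ M` and collision records on
  `Q = (ℝ³ × ℝ³) × S²` with mass and second moments `≤ M` have a COMMON weakly convergent subsequence.

PROOF NOTES. §1: Prokhorov's theorem (`isCompact_setOf_finiteMeasure_mass_le_compl_isCompact_le`)
makes `S = {μ | mass μ ≤ C, ∀ m, μ (K_mᶜ) ≤ u_m}` compact. Mathlib metrizes the weak topology only on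
`ProbabilityMeasure`, so we inject `S` continuously into the metrizable space
`ℝ≥0 × ProbabilityMeasure E` by `μ ↦ (mass μ, normalize (μ + δ_{x₀}))` — continuous by
`continuous_mass`, `ContinuousAdd (FiniteMeasure E)` and `tendsto_normalize_of_tendsto` at the NONZERO
measure `μ + δ_{x₀}`; injective since `μ + δ = mass (μ + δ) • normalize (μ + δ)`
(`self_eq_mass_smul_normalize`) and addition of finite measures is cancellative (values in `ℝ≥0`). A
continuous injection of a compact space into a Hausdorff space is a closed embedding
(`Continuous.isClosedEmbedding`), so `S` is metrizable (`IsEmbedding.metrizableSpace`), hence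
sequentially compact (`CompactSpace.tendsto_subseq`). §6: Markov on `|v|³ ≥ m + 1` off the closed ball
of radius `m + 1` and on `|v|² + |w|² ≥ m + 1` off `(B̄_{m+1} × B̄_{m+1}) × S²` with the null sequence
`u_m = max(M,0)/(m+1)`; velocity laws by `isCompact_setOf_probabilityMeasure_mass_eq_compl_isCompact_le`
and `IsCompact.tendsto_subseq` in the metrizable `ProbabilityMeasure ℝ³`
(`instMetrizableSpaceProbabilityMeasure`), records by §1 along that subsequence.

REFERENCES. P. Billingsley, *Convergence of Probability Measures*, 2nd ed., Wiley 1999, Thms 5.1–5.2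
(Prokhorov) and §2 (portmanteau / weak convergence); Yu. V. Prokhorov, *Convergence of random processes
and limit theorems in probability theory*, Teor. Veroyatnost. i Primenen. 1 (1956) 177–238.
-/

noncomputable section

namespace Summit.AtomisticToContinuum.HydrodynamicLimit.Theorems.ParityBandClosureStabilityAssembly

open scoped BigOperators Topology Classical MeasureTheory ENNReal NNReal InnerProductSpace
open Filter Set MeasureTheory
open Literature.MathematicalPhysics.KineticTheory Literature.Analysis.FluidPDE

/-! ## §1 Sequential compactness of tight, mass-bounded families of finite measures -/

section Compactness

variable {E : Type*} [MeasurableSpace E] [TopologicalSpace E] [TopologicalSpace.MetrizableSpace E]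
  [TopologicalSpace.SeparableSpace E] [BorelSpace E]

/-- **Sequential Prokhorov for finite measures.**  On a separable metrizable Borel space, a
sequence of finite measures with masses `≤ C` giving mass `≤ u m → 0` to the complements of
compact sets `K m` has a weakly convergent subsequence.  Prokhorov's theorem
(`isCompact_setOf_finiteMeasure_mass_le_compl_isCompact_le`) makes the tight set compact; it is
moreover metrizable, being continuously injected into `ℝ≥0 × ProbabilityMeasure E` by
`μ ↦ (mass μ, normalize (μ + δ_{x₀}))`, so compactness is sequential. [folklore] -/
theorem exists_subseq_tendsto_of_tight [Nonempty E] {u : ℕ → ℝ≥0} {K : ℕ → Set E} (C : ℝ≥0)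
    (hu : Tendsto u atTop (𝓝 0)) (hK : ∀ n, IsCompact (K n)) (μs : ℕ → FiniteMeasure E)
    (hmass : ∀ n, (μs n).mass ≤ C) (htight : ∀ n m, μs n (K m)ᶜ ≤ u m) :
    ∃ φ : ℕ → ℕ, StrictMono φ ∧ ∃ μ : FiniteMeasure E, Tendsto (μs ∘ φ) atTop (𝓝 μ) := by
  have hS :=
    isCompact_setOf_finiteMeasure_mass_le_compl_isCompact_le C hu hK (Or.inl inferInstance)
  set S := {μ : FiniteMeasure E | μ.mass ≤ C ∧ ∀ n, μ (K n)ᶜ ≤ u n} with hSdef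
  haveI : CompactSpace S := isCompact_iff_compactSpace.mp hS
  -- the reference atom `δ = δ_{x₀}` (mass one)
  obtain ⟨x₀⟩ := ‹Nonempty E›
  let P₀ : ProbabilityMeasure E := ⟨Measure.dirac x₀, Measure.dirac.isProbabilityMeasure⟩
  set δ : FiniteMeasure E := P₀.toFiniteMeasure with hδdef
  have hδ : δ.mass = 1 := P₀.mass_toFiniteMeasure
  have hmass_add : ∀ μ : FiniteMeasure E, (μ + δ).mass = μ.mass + 1 := fun μ => by
    rw [← hδ]; simp only [FiniteMeasure.mass, FiniteMeasure.coeFn_add, Pi.add_apply]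
  have hne : ∀ μ : FiniteMeasure E, μ + δ ≠ 0 := fun μ => by
    rw [← FiniteMeasure.mass_nonzero_iff, hmass_add]; exact ne_of_gt (by positivity)
  -- the continuous injection `Ψ μ = (mass μ, normalize (μ + δ))` into a metrizable space
  let Ψ : FiniteMeasure E → ℝ≥0 × ProbabilityMeasure E := fun μ => (μ.mass, (μ + δ).normalize)
  have hΨc : Continuous Ψ := by
    refine FiniteMeasure.continuous_mass.prodMk (continuous_iff_continuousAt.2 fun μ₀ => ?_)
    exact FiniteMeasure.tendsto_normalize_of_tendsto
      ((continuous_id.add continuous_const).tendsto μ₀) (hne μ₀)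
  have hΨi : Function.Injective Ψ := by
    intro μ₁ μ₂ h
    obtain ⟨h1, h2⟩ := Prod.mk.inj h
    have h12 : μ₁ + δ = μ₂ + δ := by
      rw [(μ₁ + δ).self_eq_mass_smul_normalize, (μ₂ + δ).self_eq_mass_smul_normalize, h2,
        hmass_add, hmass_add, h1]
    refine FiniteMeasure.eq_of_forall_apply_eq _ _ fun s _ => ?_
    have := congrArg (fun m : FiniteMeasure E => m s) h12
    simpa only [FiniteMeasure.coeFn_add, Pi.add_apply, add_left_inj] using this
  -- a continuous injection of a compact space into a Hausdorff space embeds: `S` is metrizable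
  have hemb : Topology.IsClosedEmbedding (Ψ ∘ ((↑) : S → FiniteMeasure E)) :=
    (hΨc.comp continuous_subtype_val).isClosedEmbedding (hΨi.comp Subtype.val_injective)
  letI : TopologicalSpace.MetrizableSpace S := hemb.isEmbedding.metrizableSpace
  obtain ⟨a, φ, hφ, hlim⟩ :=
    CompactSpace.tendsto_subseq (fun n => (⟨μs n, hmass n, htight n⟩ : S))
  exact ⟨φ, hφ, a.1, (continuous_subtype_val.tendsto a).comp hlim⟩

end Compactness

/-! ## §2 Markov's inequality, real form -/

/-- Markov: if `g ≥ 0` is integrable and `g ≥ r > 0` off `s`, then `μ(sᶜ) ≤ (∫ g dμ) / r`.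
[folklore] -/
theorem measureReal_compl_le_div {E : Type*} [MeasurableSpace E] (μ : Measure E)
    [IsFiniteMeasure μ] {g : E → ℝ} (hg : ∀ x, 0 ≤ g x) (hint : Integrable g μ) (s : Set E)
    {r : ℝ} (hr : 0 < r) (hs : ∀ x, x ∉ s → r ≤ g x) : μ.real sᶜ ≤ (∫ x, g x ∂μ) / r := by
  rw [le_div_iff₀ hr, mul_comm]
  refine le_trans ?_ (mul_meas_ge_le_integral_of_nonneg (ae_of_all _ hg) hint r)
  exact mul_le_mul_of_nonneg_left
    (measureReal_mono (fun x hx => hs x hx) (measure_ne_top μ _)) hr.le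

/-! ## §3 Weak convergence on bare bounded continuous functions; two limit facts -/

/-- Weak convergence of finite measures gives convergence of `∫ f` for every continuous `f` with
`|f| ≤ C`. [folklore] -/
theorem tendsto_integral_of_tendsto {E : Type*} [MeasurableSpace E] [TopologicalSpace E]
    [OpensMeasurableSpace E] {κs : ℕ → FiniteMeasure E} {κ : FiniteMeasure E}
    (h : Tendsto κs atTop (𝓝 κ)) (f : E → ℝ) (hf : Continuous f)
    (hb : ∃ C : ℝ, ∀ x, |f x| ≤ C) :
    Tendsto (fun n => ∫ x, f x ∂(κs n : Measure E)) atTop (𝓝 (∫ x, f x ∂(κ : Measure E))) := by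
  obtain ⟨C, hC⟩ := hb
  have := (FiniteMeasure.tendsto_iff_forall_integral_tendsto.mp h)
    (BoundedContinuousFunction.ofNormedAddCommGroup f hf C
      fun x => (Real.norm_eq_abs _).le.trans (hC x))
  simpa using this

/-- A real sequence converging to `L` and eventually dominated in absolute value by a null
sequence has `L = 0`. [folklore] -/
theorem limit_eq_zero_of_abs_le {a b : ℕ → ℝ} {L : ℝ} (ha : Tendsto a atTop (𝓝 L))
    (hb : Tendsto b atTop (𝓝 0)) (h : ∀ᶠ n in atTop, |a n| ≤ b n) : L = 0 := by
  have : |L| ≤ 0 := le_of_tendsto_of_tendsto ha.abs hb h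
  exact abs_nonpos_iff.mp this

/-- `1 / (φ n + 1) → 0` along a strictly increasing `φ : ℕ → ℕ`. [folklore] -/
theorem tendsto_one_div_subseq {φ : ℕ → ℕ} (hφ : StrictMono φ) :
    Tendsto (fun n => 1 / ((φ n : ℝ) + 1)) atTop (𝓝 0) :=
  (tendsto_one_div_add_atTop_nhds_zero_nat (𝕜 := ℝ)).comp hφ.tendsto_atTop

/-! ## §4 Moments of laws on `ℝ³` under a cubic bound -/

/-- Under a cubic moment bound `∫ |v|³ ≤ M` a probability law on `ℝ³` has an integrable second
moment with `∫ |v|² ≤ M + 1` (`|v|² ≤ 1 + |v|³`, landed `KacPair.sq_le_one_add_cube`).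
[folklore] -/
theorem integrable_sq_of_cube (μ : Measure V3) [IsProbabilityMeasure μ] {M : ℝ}
    (h3 : Integrable (fun v : V3 => ‖v‖ ^ 3) μ) (hM : ∫ v, ‖v‖ ^ 3 ∂μ ≤ M) :
    Integrable (fun v : V3 => ‖v‖ ^ 2) μ ∧ ∫ v, ‖v‖ ^ 2 ∂μ ≤ M + 1 := by
  have hdom : Integrable (fun v : V3 => 1 + ‖v‖ ^ 3) μ := (integrable_const 1).add h3
  have h2 : Integrable (fun v : V3 => ‖v‖ ^ 2) μ := KacPair.integrable_norm_sq h3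
  refine ⟨h2, ?_⟩
  calc ∫ v, ‖v‖ ^ 2 ∂μ ≤ ∫ v, (1 + ‖v‖ ^ 3) ∂μ :=
        integral_mono h2 hdom fun v => KacPair.sq_le_one_add_cube (norm_nonneg v)
    _ = 1 + ∫ v, ‖v‖ ^ 3 ∂μ := by rw [integral_add (integrable_const 1) h3]; simp
    _ ≤ M + 1 := by linarith

/-- Coordinates are integrable under a cubic moment bound (`|v_j| ≤ |v| ≤ 1 + |v|³`).
[folklore] -/
theorem integrable_coord (μ : Measure V3) [IsFiniteMeasure μ]
    (h3 : Integrable (fun v : V3 => ‖v‖ ^ 3) μ) (j : Fin 3) :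
    Integrable (fun v : V3 => v j) μ := by
  refine ((integrable_const (1 : ℝ)).add h3).mono' (by fun_prop) (ae_of_all _ fun v => ?_)
  rw [Real.norm_eq_abs]
  exact ((Real.norm_eq_abs _).symm.le.trans (PiLp.norm_apply_le v j)).trans
    (KacPair.le_one_add_cube (norm_nonneg v))

/-- Products of coordinates are integrable under a cubic moment bound
(`|v_j v_k| ≤ |v|² ≤ 1 + |v|³`). [folklore] -/
theorem integrable_coord_mul (μ : Measure V3) [IsFiniteMeasure μ]
    (h3 : Integrable (fun v : V3 => ‖v‖ ^ 3) μ) (j k : Fin 3) :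
    Integrable (fun v : V3 => v j * v k) μ := by
  refine ((integrable_const (1 : ℝ)).add h3).mono' (by fun_prop) (ae_of_all _ fun v => ?_)
  rw [Real.norm_eq_abs, abs_mul]
  have hj := (Real.norm_eq_abs _).symm.le.trans (PiLp.norm_apply_le v j)
  have hk := (Real.norm_eq_abs _).symm.le.trans (PiLp.norm_apply_le v k)
  calc |v j| * |v k| ≤ ‖v‖ * ‖v‖ := mul_le_mul hj hk (abs_nonneg _) (norm_nonneg _)
    _ = ‖v‖ ^ 2 := (sq _).symm
    _ ≤ 1 + ‖v‖ ^ 3 := KacPair.sq_le_one_add_cube (norm_nonneg v)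

/-- Expansion of a central second moment of a probability law in raw moments:
`∫ (v_j − u_j)(v_k − u_k) = ∫ v_j v_k − u_k ∫ v_j − u_j ∫ v_k + u_j u_k`. [folklore] -/
theorem integral_central (μ : Measure V3) [IsProbabilityMeasure μ]
    (h3 : Integrable (fun v : V3 => ‖v‖ ^ 3) μ) (u : V3) (j k : Fin 3) :
    ∫ v, (v j - u j) * (v k - u k) ∂μ =
      ∫ v, v j * v k ∂μ - u k * ∫ v, v j ∂μ - u j * ∫ v, v k ∂μ + u j * u k := by
  have hj := integrable_coord μ h3 j
  have hk := integrable_coord μ h3 k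
  have hjk := integrable_coord_mul μ h3 j k
  have e1 : ∫ v, (v j - u j) * (v k - u k) ∂μ =
      ∫ v, (v j * v k - u k * v j - u j * v k + u j * u k) ∂μ :=
    integral_congr_ae (ae_of_all _ fun v => by ring)
  rw [e1, integral_add ?_ (integrable_const _), integral_sub ?_ (hk.const_mul _),
    integral_sub hjk (hj.const_mul _), integral_const_mul, integral_const_mul, integral_const,
    probReal_univ, one_smul]
  · exact hjk.sub (hj.const_mul _)
  · exact (hjk.sub (hj.const_mul _)).sub (hk.const_mul _)

/-- Central second moments converge along a sequence of probability laws whose first and second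
raw moments converge (cubic bounds give the integrability). [folklore] -/
theorem tendsto_central (μs : ℕ → ProbabilityMeasure V3) (μ : ProbabilityMeasure V3)
    (h3s : ∀ n, Integrable (fun v : V3 => ‖v‖ ^ 3) (μs n : Measure V3))
    (h3 : Integrable (fun v : V3 => ‖v‖ ^ 3) (μ : Measure V3)) (u : V3) (j k : Fin 3)
    (h1j : Tendsto (fun n => ∫ v, v j ∂(μs n : Measure V3)) atTop
      (𝓝 (∫ v, v j ∂(μ : Measure V3))))
    (h1k : Tendsto (fun n => ∫ v, v k ∂(μs n : Measure V3)) atTop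
      (𝓝 (∫ v, v k ∂(μ : Measure V3))))
    (h2 : Tendsto (fun n => ∫ v, v j * v k ∂(μs n : Measure V3)) atTop
      (𝓝 (∫ v, v j * v k ∂(μ : Measure V3)))) :
    Tendsto (fun n => ∫ v, (v j - u j) * (v k - u k) ∂(μs n : Measure V3)) atTop
      (𝓝 (∫ v, (v j - u j) * (v k - u k) ∂(μ : Measure V3))) := by
  simp_rw [integral_central _ (h3s _) u j k, integral_central (μ : Measure V3) h3 u j k]
  exact ((h2.sub (h1j.const_mul _)).sub (h1k.const_mul _)).add tendsto_const_nhds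

/-! ## §5 The stage tests on the record space `Q = (ℝ³ × ℝ³) × S²` -/

/-- The odd stage test `Ψ = Φ − Φ ∘ J` built from a bounded continuous `Φ` is continuous, bounded
and `J`-odd (`J q = (collide q.2 q.1, −q.2)` is a continuous involution). [folklore] -/
theorem oddTest_props (Φ : (V3 × V3) × Metric.sphere (0 : V3) 1 → ℝ) (hΦc : Continuous Φ)
    (hΦb : ∃ C : ℝ, ∀ q, |Φ q| ≤ C) :
    Continuous (fun q : (V3 × V3) × Metric.sphere (0 : V3) 1 =>
      Φ q - Φ (collide q.2 q.1, -q.2)) ∧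
    (∃ C : ℝ, ∀ q : (V3 × V3) × Metric.sphere (0 : V3) 1,
      |(fun q : (V3 × V3) × Metric.sphere (0 : V3) 1 => Φ q - Φ (collide q.2 q.1, -q.2)) q| ≤ C) ∧
    (∀ q : (V3 × V3) × Metric.sphere (0 : V3) 1,
      (fun q : (V3 × V3) × Metric.sphere (0 : V3) 1 => Φ q - Φ (collide q.2 q.1, -q.2))
          (collide q.2 q.1, -q.2) =
        -(fun q : (V3 × V3) × Metric.sphere (0 : V3) 1 => Φ q - Φ (collide q.2 q.1, -q.2)) q) := by
  refine ⟨hΦc.sub (hΦc.comp ParityBandClosureDetailedBalance.continuous_inverseCollision), ?_,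
    fun q => ?_⟩
  · obtain ⟨C, hC⟩ := hΦb
    exact ⟨C + C, fun q => (abs_sub _ _).trans (add_le_add (hC _) (hC _))⟩
  · have hJJ := ParityBandClosureDetailedBalance.inverseCollision_inverseCollision q
    simp only at hJJ ⊢
    rw [hJJ]; ring

/-- The balance stage test `q ↦ c(v′) + c(w′) − c(v) − c(w)` built from a bounded continuous `c`
is continuous and bounded. [folklore] -/
theorem balanceTest_props (c : V3 → ℝ) (hc : Continuous c) (hb : ∃ C : ℝ, ∀ v, |c v| ≤ C) :
    Continuous (fun q : (V3 × V3) × Metric.sphere (0 : V3) 1 =>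
      c (collide q.2 q.1).1 + c (collide q.2 q.1).2 - c q.1.1 - c q.1.2) ∧
    ∃ C : ℝ, ∀ q : (V3 × V3) × Metric.sphere (0 : V3) 1,
      |c (collide q.2 q.1).1 + c (collide q.2 q.1).2 - c q.1.1 - c q.1.2| ≤ C := by
  have hcol : Continuous (fun q : (V3 × V3) × Metric.sphere (0 : V3) 1 => collide q.2 q.1) :=
    ParityBandClosureDetailedBalance.continuous_inverseCollision.fst
  refine ⟨by fun_prop, ?_⟩
  obtain ⟨C, hC⟩ := hb
  refine ⟨4 * C, fun q => ?_⟩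
  have h1 := abs_le.mp (hC (collide q.2 q.1).1)
  have h2 := abs_le.mp (hC (collide q.2 q.1).2)
  have h3 := abs_le.mp (hC q.1.1)
  have h4 := abs_le.mp (hC q.1.2)
  exact abs_le.mpr ⟨by linarith [h1.1, h2.1, h3.2, h4.2], by linarith [h1.2, h2.2, h3.1, h4.1]⟩

/-- Floor arithmetic: `0 ≤ X`, `0 < cmin ≤ c₀` and `c₀ X ≤ Y + η` give `X ≤ (Y + η) / cmin`.
[folklore] -/
theorem floor_le_div {X : ℝ} (hX : 0 ≤ X) {cmin c₀ Y η : ℝ} (hcmin : 0 < cmin) (hc : cmin ≤ c₀)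
    (h : c₀ * X ≤ Y + η) : X ≤ (Y + η) / cmin := by
  rw [le_div_iff₀ hcmin]
  nlinarith

/-! ## §6 Tightness of the stage sequences and extraction of convergent subsequences -/

/-- **Extraction.**  Velocity laws with `∫ |v|³ ≤ M` and collision records with mass and second
moments `≤ M` are tight (Markov), so a common subsequence converges weakly: Prokhorov in the
metrizable space `ProbabilityMeasure ℝ³` and `exists_subseq_tendsto_of_tight` on `Q`. [folklore] -/
theorem exists_subseq_pair : ∀ {M : ℝ} (P : ℕ → ProbabilityMeasure V3)
    (K : ℕ → FiniteMeasure ((V3 × V3) × Metric.sphere (0 : V3) 1)),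
    (∀ n, Integrable (fun v : V3 => ‖v‖ ^ 3) (P n : Measure V3)) →
    (∀ n, ∫ v, ‖v‖ ^ 3 ∂(P n : Measure V3) ≤ M) →
    (∀ n, ((K n : Measure ((V3 × V3) × Metric.sphere (0 : V3) 1)) Set.univ).toReal ≤ M) →
    (∀ n, Integrable (fun q : (V3 × V3) × Metric.sphere (0 : V3) 1 => ‖q.1.1‖ ^ 2 + ‖q.1.2‖ ^ 2)
      (K n : Measure ((V3 × V3) × Metric.sphere (0 : V3) 1))) →
    (∀ n, ∫ q, (‖q.1.1‖ ^ 2 + ‖q.1.2‖ ^ 2)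
      ∂(K n : Measure ((V3 × V3) × Metric.sphere (0 : V3) 1)) ≤ M) →
    ∃ φ : ℕ → ℕ, StrictMono φ ∧ ∃ (ν : ProbabilityMeasure V3)
      (κ : FiniteMeasure ((V3 × V3) × Metric.sphere (0 : V3) 1)),
      Tendsto (P ∘ φ) atTop (𝓝 ν) ∧ Tendsto (K ∘ φ) atTop (𝓝 κ) := by
  intro M P K hP3 hPM hKmass hK2 hKM
  haveI : Nonempty ((V3 × V3) × Metric.sphere (0 : V3) 1) :=
    ⟨((0, 0), ⟨EuclideanSpace.single 0 1, by simp⟩)⟩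
  set B := max M 0 with hB
  have hB0 : 0 ≤ B := le_max_right _ _
  have hm1 : ∀ m : ℕ, (1 : ℝ) ≤ m + 1 := fun m => by linarith [m.cast_nonneg (α := ℝ)]
  -- the null sequence `u m = B / (m + 1)`
  let u : ℕ → ℝ≥0 := fun m => ⟨B / (m + 1), by positivity⟩
  have hu : Tendsto u atTop (𝓝 0) := by
    rw [← NNReal.tendsto_coe]
    have := (tendsto_one_div_add_atTop_nhds_zero_nat (𝕜 := ℝ)).const_mul B
    rw [mul_zero] at this
    refine this.congr fun m => ?_
    show B * (1 / ((m : ℝ) + 1)) = B / ((m : ℝ) + 1)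
    rw [mul_one_div]
  -- velocity laws: Markov on `|v|³ ≥ m + 1` off the closed ball of radius `m + 1`
  have hPt : ∀ (n m : ℕ), P n (Metric.closedBall (0 : V3) (m + 1))ᶜ ≤ u m := by
    intro n m
    rw [← NNReal.coe_le_coe, ← ProbabilityMeasure.measureReal_eq_coe_coeFn]
    change (P n : Measure V3).real _ ≤ B / (m + 1)
    refine (measureReal_compl_le_div _ (fun v => by positivity) (hP3 n) _
      (by positivity : (0 : ℝ) < m + 1) fun v hv => ?_).trans ?_
    · have hv' : (m : ℝ) + 1 < ‖v‖ := by
        simpa [Metric.mem_closedBall, dist_zero_right] using hv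
      exact hv'.le.trans (le_self_pow₀ ((hm1 m).trans hv'.le) (by norm_num))
    · gcongr
      exact (hPM n).trans (le_max_left _ _)
  obtain ⟨ν, -, φ₁, hφ₁, hP⟩ :=
    (isCompact_setOf_probabilityMeasure_mass_eq_compl_isCompact_le hu
      (fun m => isCompact_closedBall (0 : V3) (m + 1)) (Or.inl inferInstance)).tendsto_subseq
      (x := P) fun n m => hPt n m
  -- collision records: Markov on `|v|² + |w|² ≥ m + 1` off `(B̄_{m+1} × B̄_{m+1}) × S²`
  have hKt : ∀ (n m : ℕ), K n ((Metric.closedBall (0 : V3) (m + 1) ×ˢ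
      Metric.closedBall (0 : V3) (m + 1)) ×ˢ (Set.univ : Set (Metric.sphere (0 : V3) 1)))ᶜ ≤
      u m := by
    intro n m
    rw [← NNReal.coe_le_coe, ← FiniteMeasure.measureReal_eq_coe_coeFn]
    change (K n : Measure ((V3 × V3) × Metric.sphere (0 : V3) 1)).real _ ≤ B / (m + 1)
    refine (measureReal_compl_le_div _ (fun q => by positivity) (hK2 n) _
      (by positivity : (0 : ℝ) < m + 1) fun q hq => ?_).trans ?_
    · simp only [Set.mem_prod, Set.mem_univ, and_true, Metric.mem_closedBall, dist_zero_right,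
        not_and_or, not_le] at hq
      rcases hq with h | h
      · nlinarith [norm_nonneg q.1.1, sq_nonneg ‖q.1.2‖, hm1 m]
      · nlinarith [norm_nonneg q.1.2, sq_nonneg ‖q.1.1‖, hm1 m]
    · gcongr
      exact (hKM n).trans (le_max_left _ _)
  have hKm : ∀ n, (K n).mass ≤ (⟨B, hB0⟩ : ℝ≥0) := fun n => by
    rw [← NNReal.coe_le_coe]
    change ((K n) Set.univ : ℝ) ≤ B
    rw [← FiniteMeasure.measureReal_eq_coe_coeFn, measureReal_def]
    exact (hKmass n).trans (le_max_left _ _)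
  obtain ⟨φ₂, hφ₂, κ, hK⟩ := exists_subseq_tendsto_of_tight ⟨B, hB0⟩ hu
    (fun m => ((isCompact_closedBall _ _).prod (isCompact_closedBall _ _)).prod isCompact_univ)
    (K ∘ φ₁) (fun n => hKm (φ₁ n)) fun n m => hKt (φ₁ n) m
  exact ⟨φ₁ ∘ φ₂, hφ₁.comp hφ₂, ν, κ, hP.comp hφ₂.tendsto_atTop, hK⟩

end Summit.AtomisticToContinuum.HydrodynamicLimit.Theorems.ParityBandClosureStabilityAssembly

end
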